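import Summits.CriticalPhenomena.PercolationContinuityZ3.Theorems.Transplant.FKConnectivityAllQAntipodalSquareCert
import HarnessLib

/-!
# Connectivity correlation inequalities for `φ_{w,q}`, every `q > 0` — file 77d: **BIG-SQUARE CERTIFICATES CLOSE `C_∞⁺`**

Support file (`--supports stmt-CriticalPhenomena-4575`), FK sub-lane `prim-bschramm-fk-2` (gen 37); builds on p205010 (kernel theorem, internal audit
signed; external expert review pending).  No definitions, no named facts, no sorries; standard axioms.

File 77a (`FK.levels_le_of_squareCert`) checks certificates made of ELEMENTARY squares `δ_γ + δ_{γ+e+e'} − δ_{γ+e} − δ_{γ+e'}` (`e ∈ S`,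
`e' ∉ S`).  The theta-graph theorem of gen 37 (memo FROM-fk-2-g37-THETA-THEOREM: `(ID)`, hence `C_∞⁺`, at every level for every split of every
generalised theta graph, in particular every `K_{2,n}`) produces its certificates directly as nonnegative combinations of **big squares**
`δ_γ + δ_{γ∪A∪B} − δ_{γ∪A} − δ_{γ∪B}` with `A ⊆ S` and `B` disjoint from `S` (products of two chains; in the generating-polynomial model these are the
monomial multiples of `(A⁰−A¹)(B⁰−B¹)`).  A big square is a telescoping sum of elementary squares, but it is more convenient to check it directly:
for `f` increasing reading only `S` and `g` increasing not reading `S`,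
`f̂ĝ(γ) + f̂ĝ(γ∪A∪B) − f̂ĝ(γ∪A) − f̂ĝ(γ∪B) = (f̂(γ∪A) − f̂(γ))·(ĝ(γ∪B) − ĝ(γ)) ≥ 0` (**`FK.bigSquare_hat_nonneg`**), whence a big-square
certificate of the doubly odd kernel `D_J` forces `Σ_{ℓ(γ)≤J} f̂ĝ ≤ 0` (**`FK.levels_le_of_bigSquareCert`**), exactly as in 77a.
[cite: Grimmett2006, §1.4 eq. (1.20) (p. 15); §3.8 Thm. (3.90) (pp. 61–62)] [cite: Wagner2006, Thm. 5.8(d), §5.3]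
-/

noncomputable section

namespace Summit.CriticalPhenomena.PercolationContinuityZ3.Theorems

namespace FK

open SimpleGraph Literature.Probability.LatticeModels Literature.Probability.Percolation
open scoped Classical

variable {V : Type*}

/-- **The big square is nonnegative on `f̂ĝ`.**  For finite `A ⊆ S`, `B` disjoint from `S`, `f` increasing reading only `S` and `g` increasing not
reading `S`: `f̂ĝ(γ) + f̂ĝ(γ∪A∪B) − f̂ĝ(γ∪A) − f̂ĝ(γ∪B) = (f̂(γ∪A) − f̂(γ))·(ĝ(γ∪B) − ĝ(γ)) ≥ 0` (the product of two chains of elementary squares).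
[cite: Grimmett2006, §3.8 Thm. (3.90) (pp. 61–62)] -/
theorem bigSquare_hat_nonneg (M C S : Finset (Sym2 V)) (f g : Finset (Sym2 V) → ℝ) {A B : Finset (Sym2 V)}
    (hA : A ⊆ S) (hB : ∀ b ∈ B, b ∉ S)
    (hf : ∀ a : Sym2 V, a ∉ S → ∀ X : Finset (Sym2 V), f (insert a X) = f X)
    (hg : ∀ a ∈ S, ∀ X : Finset (Sym2 V), g (insert a X) = g X)
    (hfm : ∀ ⦃X Y : Finset (Sym2 V)⦄, X ⊆ Y → f X ≤ f Y) (hgm : ∀ ⦃X Y : Finset (Sym2 V)⦄, X ⊆ Y → g X ≤ g Y)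
    (γ : Finset (Sym2 V)) :
    0 ≤ (f (γ ∪ C) - f (M \ γ ∪ C)) * (g (γ ∪ C) - g (M \ γ ∪ C)) +
        (f (γ ∪ A ∪ B ∪ C) - f (M \ (γ ∪ A ∪ B) ∪ C)) * (g (γ ∪ A ∪ B ∪ C) - g (M \ (γ ∪ A ∪ B) ∪ C)) -
        (f (γ ∪ A ∪ C) - f (M \ (γ ∪ A) ∪ C)) * (g (γ ∪ A ∪ C) - g (M \ (γ ∪ A) ∪ C)) -
        (f (γ ∪ B ∪ C) - f (M \ (γ ∪ B) ∪ C)) * (g (γ ∪ B ∪ C) - g (M \ (γ ∪ B) ∪ C)) := by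
  -- the `f`-values do not see `B`
  have f1 : f (γ ∪ A ∪ B ∪ C) = f (γ ∪ A ∪ C) := by
    refine eq_of_readOnly_inter_eq hf ?_
    ext x
    have h1 : x ∈ B → x ∉ S := fun h => hB x h
    simp only [Finset.mem_inter, Finset.mem_union]
    tauto
  have f2 : f (M \ (γ ∪ A ∪ B) ∪ C) = f (M \ (γ ∪ A) ∪ C) := by
    refine eq_of_readOnly_inter_eq hf ?_
    ext x
    have h1 : x ∈ B → x ∉ S := fun h => hB x h
    simp only [Finset.mem_inter, Finset.mem_union, Finset.mem_sdiff]
    tauto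
  have f3 : f (γ ∪ B ∪ C) = f (γ ∪ C) := by
    refine eq_of_readOnly_inter_eq hf ?_
    ext x
    have h1 : x ∈ B → x ∉ S := fun h => hB x h
    simp only [Finset.mem_inter, Finset.mem_union]
    tauto
  have f4 : f (M \ (γ ∪ B) ∪ C) = f (M \ γ ∪ C) := by
    refine eq_of_readOnly_inter_eq hf ?_
    ext x
    have h1 : x ∈ B → x ∉ S := fun h => hB x h
    simp only [Finset.mem_inter, Finset.mem_union, Finset.mem_sdiff]
    tauto
  -- the `g`-values do not see `A`
  have g1 : g (γ ∪ A ∪ B ∪ C) = g (γ ∪ B ∪ C) := by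
    refine eq_of_notRead_sdiff_eq hg ?_
    ext x
    have h1 : x ∈ A → x ∈ S := fun h => hA h
    simp only [Finset.mem_sdiff, Finset.mem_union]
    tauto
  have g2 : g (M \ (γ ∪ A ∪ B) ∪ C) = g (M \ (γ ∪ B) ∪ C) := by
    refine eq_of_notRead_sdiff_eq hg ?_
    ext x
    have h1 : x ∈ A → x ∈ S := fun h => hA h
    simp only [Finset.mem_sdiff, Finset.mem_union]
    tauto
  have g3 : g (γ ∪ A ∪ C) = g (γ ∪ C) := by
    refine eq_of_notRead_sdiff_eq hg ?_
    ext x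
    have h1 : x ∈ A → x ∈ S := fun h => hA h
    simp only [Finset.mem_sdiff, Finset.mem_union]
    tauto
  have g4 : g (M \ (γ ∪ A) ∪ C) = g (M \ γ ∪ C) := by
    refine eq_of_notRead_sdiff_eq hg ?_
    ext x
    have h1 : x ∈ A → x ∈ S := fun h => hA h
    simp only [Finset.mem_sdiff, Finset.mem_union]
    tauto
  rw [f1, f2, f3, f4, g1, g2, g3, g4]
  -- monotone factors
  have hf_up : f (γ ∪ C) ≤ f (γ ∪ A ∪ C) :=
    hfm (Finset.union_subset_union Finset.subset_union_left le_rfl)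
  have hf_dn : f (M \ (γ ∪ A) ∪ C) ≤ f (M \ γ ∪ C) :=
    hfm (Finset.union_subset_union (Finset.sdiff_subset_sdiff le_rfl Finset.subset_union_left) le_rfl)
  have hg_up : g (γ ∪ C) ≤ g (γ ∪ B ∪ C) :=
    hgm (Finset.union_subset_union Finset.subset_union_left le_rfl)
  have hg_dn : g (M \ (γ ∪ B) ∪ C) ≤ g (M \ γ ∪ C) :=
    hgm (Finset.union_subset_union (Finset.sdiff_subset_sdiff le_rfl Finset.subset_union_left) le_rfl)
  have key : (f (γ ∪ C) - f (M \ γ ∪ C)) * (g (γ ∪ C) - g (M \ γ ∪ C)) +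
        (f (γ ∪ A ∪ C) - f (M \ (γ ∪ A) ∪ C)) * (g (γ ∪ B ∪ C) - g (M \ (γ ∪ B) ∪ C)) -
        (f (γ ∪ A ∪ C) - f (M \ (γ ∪ A) ∪ C)) * (g (γ ∪ C) - g (M \ γ ∪ C)) -
        (f (γ ∪ C) - f (M \ γ ∪ C)) * (g (γ ∪ B ∪ C) - g (M \ (γ ∪ B) ∪ C)) =
      ((f (γ ∪ A ∪ C) - f (M \ (γ ∪ A) ∪ C)) - (f (γ ∪ C) - f (M \ γ ∪ C))) *
        ((g (γ ∪ B ∪ C) - g (M \ (γ ∪ B) ∪ C)) - (g (γ ∪ C) - g (M \ γ ∪ C))) := by ring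
  rw [key]
  exact mul_nonneg (by linarith) (by linarith)

/-- **Big-square certificates close `C_∞⁺`.**  If the doubly odd kernel `D_J(γ) = 1{ℓ(τγ) ≤ J} − 1{ℓ(γ) ≤ J}` (`τ` the `S`-flip) is a nonnegative
combination of big squares `δ_γ + δ_{γ∪A∪B} − δ_{γ∪A} − δ_{γ∪B}` (`A ⊆ S`, `B ⊆ M ∖ S`) — hypothesis `hcert`, in functional form, with weight
`c γ A B ≥ 0` — then the levelwise antipodal inequality holds at level `J` for every increasing `f` reading only `S` and every increasing `g` not
reading `S`.  (Elementary squares are the case `A = {e}`, `B = {e'}` of 77a.)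
[cite: Grimmett2006, §3.8 Thm. (3.90) (pp. 61–62); §3.9 (pp. 63–64)] [cite: Wagner2006, Thm. 5.8(d), §5.3] -/
theorem levels_le_of_bigSquareCert (M C S : Finset (Sym2 V)) (hS : S ⊆ M) (J : ℕ)
    (c : Finset (Sym2 V) → Finset (Sym2 V) → Finset (Sym2 V) → ℝ) (hc : ∀ γ A B, 0 ≤ c γ A B)
    (hcert : ∀ Φ : Finset (Sym2 V) → ℝ,
      ∑ γ ∈ M.powerset, ((if apExpC M C (S \ γ ∪ γ \ S) ≤ J then Φ γ else 0) - (if apExpC M C γ ≤ J then Φ γ else 0)) =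
        ∑ γ ∈ M.powerset, ∑ A ∈ S.powerset, ∑ B ∈ (M \ S).powerset,
          c γ A B * (Φ γ + Φ (γ ∪ A ∪ B) - Φ (γ ∪ A) - Φ (γ ∪ B)))
    (f g : Finset (Sym2 V) → ℝ)
    (hf : ∀ a : Sym2 V, a ∉ S → ∀ X : Finset (Sym2 V), f (insert a X) = f X)
    (hg : ∀ a ∈ S, ∀ X : Finset (Sym2 V), g (insert a X) = g X)
    (hfm : ∀ ⦃X Y : Finset (Sym2 V)⦄, X ⊆ Y → f X ≤ f Y) (hgm : ∀ ⦃X Y : Finset (Sym2 V)⦄, X ⊆ Y → g X ≤ g Y) :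
    ∑ γ ∈ M.powerset with apExpC M C γ ≤ J, (f (γ ∪ C) - f (M \ γ ∪ C)) * (g (γ ∪ C) - g (M \ γ ∪ C)) ≤ 0 := by
  set Φ : Finset (Sym2 V) → ℝ := fun γ => (f (γ ∪ C) - f (M \ γ ∪ C)) * (g (γ ∪ C) - g (M \ γ ∪ C)) with hΦ
  have key := hcert Φ
  -- the right-hand side is nonnegative
  have hR : 0 ≤ ∑ γ ∈ M.powerset, ∑ A ∈ S.powerset, ∑ B ∈ (M \ S).powerset,
      c γ A B * (Φ γ + Φ (γ ∪ A ∪ B) - Φ (γ ∪ A) - Φ (γ ∪ B)) := by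
    refine Finset.sum_nonneg fun γ _ => Finset.sum_nonneg fun A hA => Finset.sum_nonneg fun B hB => ?_
    refine mul_nonneg (hc γ A B) ?_
    have hA' : A ⊆ S := Finset.mem_powerset.1 hA
    have hB' : ∀ b ∈ B, b ∉ S := fun b hb => (Finset.mem_sdiff.1 (Finset.mem_powerset.1 hB hb)).2
    have := bigSquare_hat_nonneg M C S f g hA' hB' hf hg hfm hgm γ
    simpa only [hΦ] using this
  -- the flipped sum is minus the plain sum
  have hflip : ∑ γ ∈ M.powerset, (if apExpC M C (S \ γ ∪ γ \ S) ≤ J then Φ γ else 0) =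
      -∑ γ ∈ M.powerset, (if apExpC M C γ ≤ J then Φ γ else 0) := by
    rw [← Finset.sum_neg_distrib]
    refine Finset.sum_nbij' (fun γ => S \ γ ∪ γ \ S) (fun γ => S \ γ ∪ γ \ S) (fun γ hγ => ?_) (fun γ hγ => ?_)
      (fun γ hγ => ?_) (fun γ hγ => ?_) (fun γ hγ => ?_)
    · exact Finset.mem_powerset.2 (sflip_subset hS (Finset.mem_powerset.1 hγ))
    · exact Finset.mem_powerset.2 (sflip_subset hS (Finset.mem_powerset.1 hγ))
    · exact sflip_sflip hS (Finset.mem_powerset.1 hγ)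
    · exact sflip_sflip hS (Finset.mem_powerset.1 hγ)
    · have hγ' : γ ⊆ M := Finset.mem_powerset.1 hγ
      have hval : Φ (S \ γ ∪ γ \ S) = -Φ γ := by
        simp only [hΦ]
        rw [hat_sflip_of_readOnly (C := C) hS hγ' hf, hat_sflip_of_notRead (C := C) hS hγ' hg]
        ring
      split_ifs <;> simp [hval]
  have hL : ∑ γ ∈ M.powerset, ((if apExpC M C (S \ γ ∪ γ \ S) ≤ J then Φ γ else 0) - (if apExpC M C γ ≤ J then Φ γ else 0)) =
      -2 * ∑ γ ∈ M.powerset, (if apExpC M C γ ≤ J then Φ γ else 0) := by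
    rw [Finset.sum_sub_distrib, hflip]; ring
  rw [Finset.sum_filter]
  have : -2 * ∑ γ ∈ M.powerset, (if apExpC M C γ ≤ J then Φ γ else 0) ≥ 0 := by
    rw [← hL, key]; exact hR
  have h2 : ∑ γ ∈ M.powerset, (if apExpC M C γ ≤ J then Φ γ else 0) ≤ 0 := by linarith
  simpa only [hΦ] using h2

end FK

end Summit.CriticalPhenomena.PercolationContinuityZ3.Theorems

end
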